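import Literature.NumberTheory.EllipticCurves.CastellaGrossiLeeSkinner2022.EisensteinRankOnePPartBSD
import Literature.NumberTheory.EllipticCurves.Rank1Residual.AnomalousDictionaryPrimesAboveProofs
import Literature.NumberTheory.EllipticCurves.Rank1Residual.GVParityLineTypeProofs
import Literature.NumberTheory.EllipticCurves.Rank1Residual.X1RankOneOddPrime
import HarnessLib

/-!
# The good-Eisenstein complement of class X1, SPLIT by its Beilinson–Flach input: a Beilinson–Flach-free part (Greenberg–Vatsal 2000 ∪ Castella–Grossi–Lee–Skinner 2022 Thm. F) and the CGS-only locus (Castella–Grossi–Skinner 2025 Thm. D)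

HONEST FRAMING (cell `b2b-bsdres`, run/shared/lean/b2b/bsd-rank1-residual/): the cell deletes the
COMBINATION-SHAPED residual classes of the rank-`≤ 1` BSD formula from PUBLISHED theorems only and
types the rest; this is not "finishing BSD". `Proofs`-style file: THEOREMS ONLY (no definition, no
named fact), prover x1a gen 7, sequel of `Rank1Residual/EisensteinGoodComplement.lean` (harvest-2 /
x1a gen 6: outside X1, every good Eisenstein pair `p > 2` of analytic rank `≤ 1` satisfies `BSD(E,p)`
from Castella–Grossi–Skinner 2025 Thm. D ∪ Greenberg–Vatsal 2000 + Greenberg 1999).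

WHAT THIS FILE ADDS (second-level audit, HOME/b2b-bsdres-x1a/X1-CHAIN.md §15). The complement was
closed through ONE named fact for its whole non-anomalous part: CGS 2025 Thm. D
(`CastellaGrossiSkinner2025.thmD_padicValRat_bsd_rank_le_one`, Math. Ann. 393 (2025), REFEREED). Its
printed proof runs through Mazur's cyclotomic main conjecture (CGS Thm. A/C), whose Beilinson–Flach
input, CGS Thm. 3.1.1 of arXiv v1 = PRINTED Thm. 4.1.1 (Math. Ann. 393 (2025); v1 numbers the
Introduction §0, print §1), is in the v1 text "proved in [BST], where it is deduced from results in
[KLZ17] in combination with results in [Betina–Dimitrov–Pozzi]"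
`[corpus: paper:arxiv-2303.04373 p0016 L53–L56]`, [BST] = Burungale–Skinner–Tian, *Elliptic curves and
Beilinson–Kato elements: rank one aspects*, "preprint, 2021" `[ibid. p0029 L46–L49]` (unpublished as
of 2026-08-19; cell FRESHNESS.md W2; the cell's X10 audit, X10-AUDIT.md §8 row Y6, recorded the same
sentence for Yan–Zhu 2026), and in the ACCEPTED / PRINTED text (arXiv:2303.04373v2, TeX l. 1701–1702)
"proved in [BSTW23, §5]" with [BSTW23] = Burungale–Skinner–Tian–Wan, *Zeta elements for elliptic
curves and applications*, preprint = arXiv:2409.01350 §5 (unrefereed as of 2026-08-26; referee C R278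
words the component of record on the printed citation; version audit
`pub/bsd-uniform/ue/EISENSTEIN-AS-PRINTED.md` §3.2 — the dependence on a PREPRINT is unchanged in kind). By the cell's
own precedent (R9.1 / CITED-FACTS flags `YZ26-BF-equiv`, `BCS25-BF-equiv`) this is a PUB\* matter
for the referee (proposed flag `CGS25-BST-Thm311`), not a demotion. The present file makes the
dependence MINIMAL and EXPLICIT in the kernel:

* `bsdp_of_thmF_of_not_gvPar` — on `¬anom(p) ∧ r_an = 1 ∧ ¬gvpar(p)` (parity type A, rank one),
  `BSD(E,p)` follows from Castella–Grossi–Lee–Skinner 2022 Thm. F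
  (`CastellaGrossiLeeSkinner2022.thmF_padicValRat_bsd_rank_one`, Invent. Math. 227 (2022); proof =
  Heegner-point Kolyvagin system + BDP + control + Gross–Zagier + Kolyvagin + Greenberg–Vatsal for the
  twist: NO Beilinson–Flach class), modularity and GZK; `bsdp_of_thmF_of_cgls` is the same with both
  hypotheses on `φ` in their printed Galois form (decomposition group at any prime above `p`).
* `bsdp_of_bfFreeLocus` — the Beilinson–Flach-free locus
  `(r_an = 0 ∧ gvpar(p)) ∨ (¬anom(p) ∧ r_an = 1 ∧ ¬gvpar(p))` is closed by GV 2000 + Greenberg 1999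
  (rank `0`, C7 chain) ∪ CGLS 2022 Thm. F (rank `1`).
* `bsdp_or_classX1_or_cgsOnlyLocus` — TRICHOTOMY granted only the BF-free facts: at every good
  Eisenstein `p > 2` with `r_an ≤ 1`, `BSD(E,p)` ∨ X1 ∨ the **CGS-only locus**
  `¬anom(p) ∧ ((r_an = 0 ∧ ¬gvpar(p)) ∨ (r_an = 1 ∧ gvpar(p)))`, i.e. the non-anomalous pairs of
  parity type A in rank `0` and of type B in rank `1` — exactly the population for which CGS 2025
  removed "a certain parity hypothesis on `φ`" (their remark after Thm. D) and for which no
  Beilinson–Flach-free proof is in print.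
* `bsdp_of_cgsOnlyLocus` (CGS Thm. D closes it) and `bsdp_of_not_classX1_split` (re-assembly = the
  conclusion of `bsdp_of_not_classX1`, dependence on CGS confined to the CGS-only locus).
* PAIR BY PAIR the CGS-only locus is Beilinson–Flach-free modulo one finite certificate:
  `bsdp_of_good_red_rankZero_of_shaAn_unit` (rank `0`: Wuthrich 2014 Prop. 21 = Kato, certificate
  `p ∤ #Ш_an(E)`), `bsdp_of_good_red_gvPar_rankOne_of_schneider` (rank `1` under (GV): Greenberg–Vatsal
  + Perrin-Riou–Schneider + Perrin-Riou 1987 + Mazur–Tate sigma, certificate = Schneider's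
  non-degeneracy of the canonical `p`-adic height; x1b's odd-prime engine), assembled as
  `bsdp_of_cgsOnlyLocus_of_certificate`. So the [BST]-dependence is a CLASS-LEVEL matter only.

So, in the cell's census language: C7 (`r = 0 ∧ gvpar`) and C6 ∩ {`r = 1 ∧ ¬gvpar`} are closed
from Beilinson–Flach-free print; C6 ∩ ({`r = 0 ∧ ¬gvpar`} ∪ {`r = 1 ∧ gvpar`}) is closed by CGS
2025 Thm. D alone (PUB, proof importing [BST] PRE). No label is changed here; numbers (census split
`N < 2·10⁴`) are in X1-CHAIN §15. SECOND-LEVEL NOTES kept with the facts' docstrings: CGLS §3.2's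
standing "`p ∤ 6N`" vs its theorems' "`p > 2`" (flag proposal `CGLS22-§3-6N@3`), Castella–Hsieh
2018 Hypothesis (H)(a) "`p ∤ 2(2r−1)!Nφ(N)`" behind the `Λ`-adic Heegner classes / BDP measure used by
CGLS (no `φ(N)` condition is stated by CGLS/CGS/Keller–Yin), Burungale–Castella–Kim 2021 "`p > 3`"
behind CGLS Prop. 4.2.1 ("whose proof still applies").

## References
* [CastellaGrossiLeeSkinner2022] Invent. Math. 227 (2022) 517–580 = arXiv:2008.02571, Thm. F =
  Thm. 5.3.1, §3.2, Prop. 4.2.1, §5.3.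
* [CastellaGrossiSkinner2025] Math. Ann. 393 (2025) 2451–2506 = arXiv:2303.04373v2, Thm. D,
  Thm. 3.1.1 (proof sentence), §5 (p ∤ 2N).
* [GreenbergVatsal2000] Invent. Math. 142 (2000) Thm. (1.3); [GreenbergLNM1716] Thm. 4.1.
* F. Castella, M.-L. Hsieh, Math. Ann. 370 (2018), Hypothesis (H).
* A. Burungale, F. Castella, C.-H. Kim, Algebra Number Theory 15 (2021) (standing `p > 3`).
* RESIDUAL-CASES.md §a.1 C6/C7, §a.2 X1; HOME/CITED-FACTS.md rows A47 (CGS Thm. D), C28 (CGLS Thm. F);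
  X10-AUDIT.md §8 row Y6; FRESHNESS.md W2.
-/

set_option autoImplicit false

noncomputable section


open scoped Classical NumberField Pointwise

open WeierstrassCurve Literature.NumberTheory.EllipticCurves Literature.NumberTheory.GaloisRepresentations
  Literature.NumberTheory.EllipticCurves.ModularForms Field IsDedekindDomain NumberField Rat.HeightOneSpectrum
  Literature.NumberTheory.EllipticCurves.Wuthrich2014 Literature.NumberTheory.EllipticCurves.Rank1Residual

namespace Literature.NumberTheory.EllipticCurves.Rank1Residual

/-- **A curve of parity type A carries a rational line of Castella–Grossi–Lee–Skinner's co-type.** For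
`W/ℚ` elliptic with `E[p]` reducible and `¬ GVPar W p`, some rational line `Φ ≤ E[p]` is
(ramified at `p` ∧ odd) ∨ (unramified at `p` ∧ even) — the parity hypothesis of CGLS 2022 Thm. F.
(`exists_isRationalLine_of_not_irr` + `coType_of_not_gvPar`.) [folklore] -/
theorem exists_coTypeLine_of_red_of_not_gvPar (W : WeierstrassCurve ℚ) [W.IsElliptic] (p : ℕ)
    [Fact p.Prime] (hred : Red W p) (hnpar : ¬ GVPar W p) :
    ∃ Φ : AddSubgroup (geomTorsion W (p : ℤ)), IsRationalLine W p Φ ∧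
      ((¬ LineUnramifiedAt W p Φ ∧ LineOdd W p Φ) ∨ (LineUnramifiedAt W p Φ ∧ LineEven W p Φ)) := by
  obtain ⟨Φ, hΦ⟩ := exists_isRationalLine_of_not_irr W p hred
  exact ⟨Φ, hΦ, (coType_of_not_gvPar hΦ hnpar).symm⟩

/-- **C6, Beilinson–Flach-free part, rank one: CGLS 2022 Thm. F ⇒ `BSD(E,p)` on
`¬anom(p) ∧ r_an = 1 ∧ ¬gvpar(p)`.** For `W/ℚ` globally minimal elliptic, `2 < p` good with `E[p]`
reducible, `a_p ≢ 1 (mod p)`, parity type A (`¬ GVPar W p`) and `ord_{s=1} L(E,s) = 1`: `BSDp W p`,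
from the named fact `CastellaGrossiLeeSkinner2022.thmF_padicValRat_bsd_rank_one`, modularity and
Gross–Zagier–Kolyvagin — NO Castella–Grossi–Skinner 2025 input (hence no Beilinson–Flach / [BST]
input). Ordinarity is `goodOrd_of_red_of_good` (Serre Prop. 12), the co-type line is
`exists_coTypeLine_of_red_of_not_gvPar`, the torsion bit is `not_dvd_torsionOrder_of_not_anom`.
[cite: CastellaGrossiLeeSkinner2022, Theorem F = Thm. 5.3.1] [cite: Miller2011LMS, Def. 1.1] -/
theorem bsdp_of_thmF_of_not_gvPar
    (hF : CastellaGrossiLeeSkinner2022.thmF_padicValRat_bsd_rank_one)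
    (hmod : hasEntireLFunction_rat) (hGZK : rank_eq_analyticRank_of_analyticRank_le_one)
    (W : WeierstrassCurve ℚ) [W.IsElliptic] [W.IsGloballyMinimal] (p : ℕ) [Fact p.Prime]
    (hp : 2 < p) (hgood : Good W p) (hred : Red W p) (hna : ¬ Anom W p) (hnpar : ¬ GVPar W p)
    (hr1 : W.analyticRank = 1) : BSDp W p :=
  CastellaGrossiLeeSkinner2022.bsdp_of_thmF hF hmod hGZK W p hp (goodOrd_of_red_of_good W p hp hgood hred)
    (exists_coTypeLine_of_red_of_not_gvPar W p hred hnpar) hna hr1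
    (not_dvd_torsionOrder_of_not_anom W p hp hgood hna)

variable {W : WeierstrassCurve ℚ} [W.IsElliptic] [W.IsGloballyMinimal] {p : ℕ} [Fact p.Prime]

set_option synthInstance.maxHeartbeats 100000 in
/-- **CGLS 2022 Thm. F with BOTH hypotheses on `φ` AS PRINTED ⇒ `BSD(E,p)`.** `W/ℚ` globally minimal
elliptic with `ord_{s=1} L(E,s) = 1`, `p > 2` good ordinary, the kernel `Φ` of a rational `p`-isogeny,
a prime `𝔓'` above `p` whose decomposition group neither fixes `Φ` pointwise ("`φ|_{G_p} ≠ 1`") nor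
acts trivially on `E[p]/Φ` ("`φ|_{G_p} ≠ ω`"), and `Φ` (ramified at `p` ∧ odd) ∨ (unramified at `p` ∧
even) ⇒ `BSDp W p` — from the named fact (its `¬anom(p)` DERIVED by
`not_anom_iff_cgs_of_mem_primesAbove`), modularity, Gross–Zagier–Kolyvagin. Beilinson–Flach-free.
[cite: CastellaGrossiLeeSkinner2022, Theorem F = Thm. 5.3.1] -/
theorem bsdp_of_thmF_of_cgls (hF : CastellaGrossiLeeSkinner2022.thmF_padicValRat_bsd_rank_one)
    (hmod : hasEntireLFunction_rat) (hGZK : rank_eq_analyticRank_of_analyticRank_le_one)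
    (hp : 2 < p) (hord : GoodOrd W p)
    {v : HeightOneSpectrum (𝓞 ℚ)} (hv : (primesEquiv v : ℕ) = p)
    {𝔓' : Ideal (absIntegers (𝓞 ℚ) ℚ)} (h𝔓' : 𝔓' ∈ v.primesAbove)
    {Φ : AddSubgroup (geomTorsion W (p : ℤ))} (hΦ : IsRationalLine W p Φ)
    (hφ1 : ¬ ∀ g ∈ 𝔓'.decompositionSubgroup (absoluteGaloisGroup ℚ), ∀ P ∈ Φ, g • P = P)
    (hφω : ¬ ∀ g ∈ 𝔓'.decompositionSubgroup (absoluteGaloisGroup ℚ), ∀ P : geomTorsion W (p : ℤ),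
      g • P - P ∈ Φ)
    (hpar : (¬ LineUnramifiedAt W p Φ ∧ LineOdd W p Φ) ∨ (LineUnramifiedAt W p Φ ∧ LineEven W p Φ))
    (hr1 : W.analyticRank = 1) : BSDp W p :=
  have hna : ¬ Anom W p := (not_anom_iff_cgs_of_mem_primesAbove hp hord.1 hv h𝔓' hΦ).mpr ⟨hφ1, hφω⟩
  CastellaGrossiLeeSkinner2022.bsdp_of_thmF hF hmod hGZK W p hp hord ⟨Φ, hΦ, hpar⟩ hna hr1
    (not_dvd_torsionOrder_of_not_anom W p hp hord.1 hna)

/-- **The Beilinson–Flach-free part of the good-Eisenstein complement (C6 ∪ C7 minus the CGS-only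
locus).** For `W/ℚ` globally minimal elliptic, `2 < p` good with `E[p]` reducible, `r_an ≤ 1`, on the
locus `(r_an = 0 ∧ gvpar(p)) ∨ (¬anom(p) ∧ r_an = 1 ∧ ¬gvpar(p))`: `BSDp W p` from
Greenberg–Vatsal 2000 Thm. 1.3 + Greenberg LNM 1716 Thm. 4.1 (`hGV`, `hGr`; rank `0`, C7 chain) and
Castella–Grossi–Lee–Skinner 2022 Thm. F (`hF`; rank `1`), modularity and Gross–Zagier–Kolyvagin — all
PUBLISHED and none importing a Beilinson–Flach class (no Castella–Grossi–Skinner 2025 input).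
[cite: GreenbergVatsal2000, Thm. (1.3)] [cite: GreenbergLNM1716, Thm. 4.1]
[cite: CastellaGrossiLeeSkinner2022, Theorem F = Thm. 5.3.1] [cite: Miller2011LMS, Def. 1.1] -/
theorem bsdp_of_bfFreeLocus
    (hGV : GreenbergVatsal2000.thm13_charIdeal_eq_of_gvPar) (hGr : greenberg_charValue_rankZero)
    (hF : CastellaGrossiLeeSkinner2022.thmF_padicValRat_bsd_rank_one)
    (hmod : hasEntireLFunction_rat) (hmodP : nonempty_modularParametrizationData)
    (hGZK : rank_eq_analyticRank_of_analyticRank_le_one)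
    (W : WeierstrassCurve ℚ) [W.IsElliptic] [W.IsGloballyMinimal] (p : ℕ) [Fact p.Prime]
    (hp : 2 < p) (hgood : Good W p) (hred : Red W p)
    (hloc : (W.analyticRank = 0 ∧ GVPar W p) ∨ (¬ Anom W p ∧ W.analyticRank = 1 ∧ ¬ GVPar W p)) :
    BSDp W p := by
  rcases hloc with ⟨hr0, hpar⟩ | ⟨hna, hr1, hnpar⟩
  · exact bsdp_of_gvPar_of_analyticRank_eq_zero hGV hGr hmod hmodP hGZK W p (by omega)
      (goodOrd_of_red_of_good W p hp hgood hred) hpar hr0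
  · exact bsdp_of_thmF_of_not_gvPar hF hmod hGZK W p hp hgood hred hna hnpar hr1

/-- **The good-Eisenstein TRICHOTOMY of the published record, refined by the Beilinson–Flach input
(rank `≤ 1`, `p > 2`).** For `W/ℚ` globally minimal elliptic, `2 < p` good with `E[p]` reducible and
`ord_{s=1} L(E,s) ≤ 1`, granted ONLY the Beilinson–Flach-free published facts (Greenberg–Vatsal 2000,
Greenberg 1999, Castella–Grossi–Lee–Skinner 2022 Thm. F, modularity, GZK): EITHER `BSD(E,p)` holds,
OR the pair is in residual class X1 (`anom(p) ∧ ¬(r_an = 0 ∧ gvpar(p))`), OR it lies on the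
"CGS-only locus" `¬anom(p) ∧ ((r_an = 0 ∧ ¬gvpar(p)) ∨ (r_an = 1 ∧ gvpar(p)))` — the non-anomalous
pairs whose ONLY printed closing theorem is Castella–Grossi–Skinner 2025 Thm. D (via their cyclotomic
main conjecture Thm. A/C, whose Beilinson–Flach input Thm. 4.1.1 (arXiv v1: Thm. 3.1.1) is "proved in
[BSTW23, §5]" = Burungale–Skinner–Tian–Wan arXiv:2409.01350 §5, preprint (v1: "[BST]", preprint 2021);
`bsdp_of_cgsOnlyLocus` below closes it from that fact). Pure case analysis on `anom`, `r_an ∈ {0,1}`,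
`gvpar`. [cite: CastellaGrossiLeeSkinner2022, Theorem F = Thm. 5.3.1] [cite: GreenbergVatsal2000, Thm. (1.3)]
[cite: CastellaGrossiSkinner2025, Thm. 4.1.1 (proof sentence, TeX l. 1701–1702; arXiv v1: Thm. 3.1.1) and Theorem D (§1.2)] -/
theorem bsdp_or_classX1_or_cgsOnlyLocus
    (hGV : GreenbergVatsal2000.thm13_charIdeal_eq_of_gvPar) (hGr : greenberg_charValue_rankZero)
    (hF : CastellaGrossiLeeSkinner2022.thmF_padicValRat_bsd_rank_one)
    (hmod : hasEntireLFunction_rat) (hmodP : nonempty_modularParametrizationData)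
    (hGZK : rank_eq_analyticRank_of_analyticRank_le_one)
    (W : WeierstrassCurve ℚ) [W.IsElliptic] [W.IsGloballyMinimal] (p : ℕ) [Fact p.Prime]
    (hp : 2 < p) (hgood : Good W p) (hred : Red W p) (hr : W.analyticRank ≤ 1) :
    BSDp W p ∨ ClassX1 W p ∨
      (¬ Anom W p ∧ ((W.analyticRank = 0 ∧ ¬ GVPar W p) ∨ (W.analyticRank = 1 ∧ GVPar W p))) := by
  by_cases hna : Anom W p
  · by_cases hrg : W.analyticRank = 0 ∧ GVPar W p
    · exact Or.inl (bsdp_of_bfFreeLocus hGV hGr hF hmod hmodP hGZK W p hp hgood hred (Or.inl hrg))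
    · exact Or.inr (Or.inl ⟨hp, hred, hgood, hna, hrg⟩)
  · rcases Nat.le_one_iff_eq_zero_or_eq_one.mp hr with hr0 | hr1
    · by_cases hpar : GVPar W p
      · exact Or.inl
          (bsdp_of_bfFreeLocus hGV hGr hF hmod hmodP hGZK W p hp hgood hred (Or.inl ⟨hr0, hpar⟩))
      · exact Or.inr (Or.inr ⟨hna, Or.inl ⟨hr0, hpar⟩⟩)
    · by_cases hpar : GVPar W p
      · exact Or.inr (Or.inr ⟨hna, Or.inr ⟨hr1, hpar⟩⟩)
      · exact Or.inl
          (bsdp_of_bfFreeLocus hGV hGr hF hmod hmodP hGZK W p hp hgood hred (Or.inr ⟨hna, hr1, hpar⟩))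

/-- **The CGS-only locus is closed by Castella–Grossi–Skinner 2025 Thm. D** (the named fact of the
sibling file; PUBLISHED, Math. Ann. 393 (2025); its printed proof imports Thm. 4.1.1 (arXiv v1:
Thm. 3.1.1) "proved in [BSTW23, §5]" = arXiv:2409.01350 §5, preprint (v1: "[BST]", preprint 2021) —
flag `CGS25-BST-Thm311`, referee A R156.2): for `W/ℚ` globally minimal
elliptic, `2 < p` good with `E[p]` reducible, `r_an ≤ 1` and `¬anom(p)`: `BSDp W p`
(`bsdp_of_thmD_of_not_anom`; the parity datum is not needed by Thm. D). Recorded next to the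
trichotomy so that the two closing theorems of the complement are side by side.
[cite: CastellaGrossiSkinner2025, Theorem D] -/
theorem bsdp_of_cgsOnlyLocus
    (hD : CastellaGrossiSkinner2025.thmD_padicValRat_bsd_rank_le_one)
    (hmod : hasEntireLFunction_rat) (hGZK : rank_eq_analyticRank_of_analyticRank_le_one)
    (W : WeierstrassCurve ℚ) [W.IsElliptic] [W.IsGloballyMinimal] (p : ℕ) [Fact p.Prime]
    (hp : 2 < p) (hgood : Good W p) (hred : Red W p) (hr : W.analyticRank ≤ 1)
    (hloc : ¬ Anom W p ∧ ((W.analyticRank = 0 ∧ ¬ GVPar W p) ∨ (W.analyticRank = 1 ∧ GVPar W p))) :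
    BSDp W p :=
  bsdp_of_thmD_of_not_anom hD hmod hGZK W p hp hgood hred hloc.1 hr

/-- **C6 ∪ C7 re-assembled from the split** (sanity: the split loses nothing). Outside X1, every good
Eisenstein pair `p > 2` of analytic rank `≤ 1` satisfies `BSD(E,p)`: the BF-free part from GV /
Greenberg / CGLS Thm. F, the CGS-only locus from CGS Thm. D — the same conclusion as
`bsdp_of_not_classX1`, now with the dependence on CGS 2025 confined to the CGS-only locus.
[cite: CastellaGrossiLeeSkinner2022, Theorem F = Thm. 5.3.1] [cite: CastellaGrossiSkinner2025, Theorem D]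
[cite: GreenbergVatsal2000, Thm. (1.3)] -/
theorem bsdp_of_not_classX1_split
    (hGV : GreenbergVatsal2000.thm13_charIdeal_eq_of_gvPar) (hGr : greenberg_charValue_rankZero)
    (hF : CastellaGrossiLeeSkinner2022.thmF_padicValRat_bsd_rank_one)
    (hD : CastellaGrossiSkinner2025.thmD_padicValRat_bsd_rank_le_one)
    (hmod : hasEntireLFunction_rat) (hmodP : nonempty_modularParametrizationData)
    (hGZK : rank_eq_analyticRank_of_analyticRank_le_one)
    (W : WeierstrassCurve ℚ) [W.IsElliptic] [W.IsGloballyMinimal] (p : ℕ) [Fact p.Prime]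
    (hp : 2 < p) (hgood : Good W p) (hred : Red W p) (hr : W.analyticRank ≤ 1)
    (hX : ¬ ClassX1 W p) : BSDp W p := by
  rcases bsdp_or_classX1_or_cgsOnlyLocus hGV hGr hF hmod hmodP hGZK W p hp hgood hred hr with
    h | h | h
  · exact h
  · exact absurd h hX
  · exact bsdp_of_cgsOnlyLocus hD hmod hGZK W p hp hgood hred hr h

/-! ### The CGS-only locus, pair by pair: Beilinson–Flach-free PUBLISHED routes modulo a per-pair certificate

At CLASS level the CGS-only locus has no Beilinson–Flach-free closing theorem in print. Per pair it
does, modulo a finite certificate, and both routes were already in the tree (x1b gens 1–4) without any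
class-X1 / anomaly hypothesis: rank `0` — Wuthrich 2014 Prop. 21 (Kato's divisibility, integral at a
reducible odd `p`) when `p ∤ #Ш_an(E)`; rank `1` under (GV) — Greenberg–Vatsal's main conjecture +
Perrin-Riou–Schneider + Perrin-Riou 1987 + Mazur–Tate sigma + GZK modulo Schneider's non-degeneracy of
the canonical `p`-adic height. The two theorems below only SPECIALISE those to the locus, so that the
census statement "every CGS-only pair has a BF-free route modulo a certificate" names its kernel
theorems. -/

/-- **CGS-only locus, rank `0` (`¬anom ∧ r_an = 0 ∧ ¬gvpar`), per pair: Wuthrich 2014 Prop. 21.** For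
`W/ℚ` globally minimal elliptic, `2 < p` good with `E[p]` reducible, `ord_{s=1} L(E,s) = 0` and the
certificate "`#Ш(E/ℚ)_an` is a rational number of `p`-adic valuation `0`": `BSDp W p`, from Wuthrich's
Prop. 21 (`hW = sha_dvd_analyticSha`: `#Ш ∣ #Ш_an` away from additive and small-image primes),
modularity and Gross–Zagier–Kolyvagin — Beilinson–Flach-free (Kato's Euler system). Neither the parity
type nor `¬anom` is needed; stated here for the locus' rank-`0` half (lever L1 of RESIDUAL-CASES §a.3,
the class-free tree theorem `Wuthrich2014.bsdp_of_L_one_ne_zero_of_padicValRat_shaAn_eq_zero`).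
[cite: Wuthrich2014, Prop. 21 (p. 400)] [cite: Miller2011LMS, Def. 1.1] -/
theorem bsdp_of_good_red_rankZero_of_shaAn_unit (hW : sha_dvd_analyticSha)
    (hmod : hasEntireLFunction_rat) (hGZK : rank_eq_analyticRank_of_analyticRank_le_one)
    (W : WeierstrassCurve ℚ) [W.IsElliptic] [W.IsGloballyMinimal] (p : ℕ) [Fact p.Prime]
    (hp : 2 < p) (hgood : Good W p) (hred : Red W p) (hr0 : W.analyticRank = 0)
    (hunit : ∃ q : ℚ, shaAn W = (q : ℂ) ∧ padicValRat p q = 0) : BSDp W p :=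
  bsdp_of_L_one_ne_zero_of_padicValRat_shaAn_eq_zero hW hGZK W p (by omega)
    ((W.analyticRank_eq_zero_iff_holds (hmod W)).mp hr0)
    (WeierstrassCurve.HasGoodReduction.not_hasAdditiveReduction (R := ℤ_[p]) hgood) (Or.inl hred) hunit

/-- **CGS-only locus, rank `1` (`¬anom ∧ r_an = 1 ∧ gvpar`), per pair: Greenberg–Vatsal + the odd-prime
rank-one engine, modulo the Schneider certificate.** For `W/ℚ` globally minimal elliptic, `2 < p` good
with `E[p]` reducible, `GVPar W p`, `ord_{s=1} L(E,s) = 1` and Schneider's non-degeneracy of the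
canonical `p`-adic height at `(E,p)` (`hSch`, certified per pair by a finite `p`-adic computation):
`BSDp W p`, from Greenberg–Vatsal 2000 Thm. 1.3 (`hGV`), Perrin-Riou–Schneider (`hS`, BMS 2016 Thm. 1.7
at `p > 2`), Perrin-Riou 1987 (`hPR`), the Mazur–Tate sigma pair (`hMT`), modularity and GZK — x1b's
`bsdp_of_gvPar_of_analyticRank_eq_one_odd` with ordinarity supplied by `goodOrd_of_red_of_good`; no
Castella–Grossi–Skinner, no Wuthrich, no Keller–Yin input; Beilinson–Flach-free.
[cite: GreenbergVatsal2000, Thm. (1.3)] [cite: BalakrishnanMullerStein2015, Thm. 1.7]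
[cite: PerrinRiou1987, §1.4 Cor. 1.8] [cite: Miller2011LMS, Def. 1.1] -/
theorem bsdp_of_good_red_gvPar_rankOne_of_schneider
    (hGV : GreenbergVatsal2000.thm13_charIdeal_eq_of_gvPar)
    (hS : Schneider1985_order_charGenerator_odd) (hPR : perrinRiou_rankOne_leadingTerms_odd)
    (hMT : mazur_tate_sigma_exists_odd) (hmodP : nonempty_modularParametrizationData)
    (hGZK : rank_eq_analyticRank_of_analyticRank_le_one)
    (W : WeierstrassCurve ℚ) [W.IsElliptic] [W.IsGloballyMinimal] (p : ℕ) [Fact p.Prime]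
    (hp : 2 < p) (hgood : Good W p) (hred : Red W p) (hpar : GVPar W p) (hr1 : W.analyticRank = 1)
    (hSch : ∀ Dh : PAdicHeightData W p, Dh.IsCanonical → SchneiderConjecture Dh) : BSDp W p :=
  bsdp_of_gvPar_of_analyticRank_eq_one_odd hGV hS hPR hMT hmodP hGZK W p (by omega) hgood
    (goodOrd_of_red_of_good W p hp hgood hred).2 hpar hr1 hSch

/-- **The CGS-only locus is Beilinson–Flach-free PAIR BY PAIR, modulo one finite certificate per
pair.** On `¬anom(p) ∧ ((r_an = 0 ∧ ¬gvpar(p)) ∨ (r_an = 1 ∧ gvpar(p)))` (`2 < p` good, `E[p]`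
reducible): `BSDp W p` from PUBLISHED, Beilinson–Flach-free facts (Wuthrich 2014 Prop. 21 /
Greenberg–Vatsal 2000 + Perrin-Riou–Schneider + Perrin-Riou 1987 + Mazur–Tate, modularity, GZK) given
the rank-`0` certificate `p ∤ #Ш_an(E)` (`hunit`, consulted only at `r_an = 0`) resp. the rank-`1`
Schneider certificate (`hSch`, consulted only at `r_an = 1`). So the [BST]-dependence flagged
`CGS25-BST-Thm311` is a CLASS-LEVEL matter only: per pair the lane's levers L1 (and its Cassels/CT
variants for `p ∣ #Ш_an`) and the x1b rank-one certificate route cover the locus without CGS 2025.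
[cite: Wuthrich2014, Prop. 21 (p. 400)] [cite: GreenbergVatsal2000, Thm. (1.3)]
[cite: BalakrishnanMullerStein2015, Thm. 1.7] [cite: PerrinRiou1987, §1.4 Cor. 1.8] -/
theorem bsdp_of_cgsOnlyLocus_of_certificate (hW : sha_dvd_analyticSha)
    (hGV : GreenbergVatsal2000.thm13_charIdeal_eq_of_gvPar)
    (hS : Schneider1985_order_charGenerator_odd) (hPR : perrinRiou_rankOne_leadingTerms_odd)
    (hMT : mazur_tate_sigma_exists_odd) (hmod : hasEntireLFunction_rat)
    (hmodP : nonempty_modularParametrizationData) (hGZK : rank_eq_analyticRank_of_analyticRank_le_one)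
    (W : WeierstrassCurve ℚ) [W.IsElliptic] [W.IsGloballyMinimal] (p : ℕ) [Fact p.Prime]
    (hp : 2 < p) (hgood : Good W p) (hred : Red W p)
    (hloc : ¬ Anom W p ∧ ((W.analyticRank = 0 ∧ ¬ GVPar W p) ∨ (W.analyticRank = 1 ∧ GVPar W p)))
    (hunit : W.analyticRank = 0 → ∃ q : ℚ, shaAn W = (q : ℂ) ∧ padicValRat p q = 0)
    (hSch : W.analyticRank = 1 → ∀ Dh : PAdicHeightData W p, Dh.IsCanonical → SchneiderConjecture Dh) :
    BSDp W p := by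
  rcases hloc.2 with ⟨hr0, -⟩ | ⟨hr1, hpar⟩
  · exact bsdp_of_good_red_rankZero_of_shaAn_unit hW hmod hGZK W p hp hgood hred hr0 (hunit hr0)
  · exact bsdp_of_good_red_gvPar_rankOne_of_schneider hGV hS hPR hMT hmodP hGZK W p hp hgood hred hpar
      hr1 (hSch hr1)

end Literature.NumberTheory.EllipticCurves.Rank1Residual

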